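import Summits.AtomisticToContinuum.HydrodynamicLimit.Theses.StiffCollisionalRelaxation

/-!
# Birth skeleton of the crux `RelEntropyStability` (stmt-AtomisticToContinuum-9520)

Route `route-AtomisticToContinuum-StiffCollisionalRelaxation`, crux decl
`Summit.AtomisticToContinuum.HydrodynamicLimit.Theses.StiffCollisionalRelaxation.RelEntropyStability`
(the deterministic PDE half of the line: Dafermos/DiPerna/Tzavaras relative-entropy stability of a
classical hard-sphere Euler solution `U_cl` on `𝕋³` against ANY bounded measurable x-continuous field
`U` with values in the cell chamber `{c₁ ≤ ρ, ρσ³ ≤ 1, |m|² < 2ρE}`, small initial relative entropy,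
approximate GLOBAL entropy inequality, exponentially small hot-cell functional and small weak residual
tested against `Λ = Dη_σ(U_cl)`; conclusion in `L¹`).
Skeleton registrar `planner-skel-stmt-AtomisticToContinuum-9520-0`, 2026-08-17 (BC3 birth certificate;
re-audit bin REPAIRABLE). Nothing here restates the crux or the Statement: the three stubs are the three
moves of Dafermos 2005 Thm 5.2.1 / (5.2.14) WITH DEFECT FORCING, organised around ONE intermediate
quantity, the relative entropy functional

  `H(τ) = ∫ h(U(τ,x) | U_cl(τ,x)) dx`,  `h(U | Ū) = η_σ(U) − η_σ(Ū) − Dη_σ(Ū)(U − Ū)`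

(`relEntropy` below; at `τ = 0` it is verbatim the crux's initial hypothesis), exactly the route
header's foreseen layer-2 cut "RelEntropyStability ⇐ RelEntropyIdentityTorus (Dafermos (5.2.14) with
defect forcing) → GronwallWithHotCells" plus the coercivity step that the crux's `L¹` conclusion needs:

* `stub_relEntropyBalance` (S1, size M–L): the RELATIVE ENTROPY BALANCE WITH DEFECTS — for every
  competitor `U` satisfying the approximate entropy inequality (`+δ`) and the weak-residual bound (`δ`)
  against `Λ`, for all `τ ≤ t₁`,
  `H(τ) ≤ H(0) + 2δ − ∫₀^τ ∫ Σ_j ∂_jΛ · [F_j(U) − F_j(U_cl) − DF_j(U_cl)(U − U_cl)] dx ds`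
  (entropy CONSERVATION of the classical solution — the hard-sphere law `p = ρθ(1 + η f_ex'(η))` is
  Gibbs-consistent with `η_σ = −ρs` —, the exact tested identity `[∫Λ·U_cl]₀^τ = ∫₀^τ∫(∂_sΛ·U_cl +
  Σ_j ∂_jΛ·F_j(U_cl))`, and the entropy/flux compatibility `∂_sΛ·V = −Σ_j ∂_jΛ·DF_j(U_cl)V`, i.e. the
  symmetry of `D²η_σ DF_j`; Dafermos (5.2.14) on `𝕋³`).
* `stub_gronwallHotCells` (S2, THE HEART, size L): GRÖNWALL WITH HOT CELLS — given the balance of S1,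
  `H(0) ≤ δ` and the hot-cell functional `∫₀^{t₁}∫ 1(E > Mρ)(E^{3/2}ρ^{-1/2} + E + ρ) ≤ C e^{−λM}`
  (`M ≥ 1`), `H(τ) ≤ ε'` for all `τ ≤ t₁` once `δ` is small: on `{E ≤ Mρ} ∩ chamber` the paired flux
  remainder is `≤ K√M · h` (quadratic/quadratic near `U_cl` by strong convexity and `F_j ∈ C²` inside
  `{ρσ³ < η₀}`, bounded/linear far from it by ray-monotonicity of the Bregman divergence of the convex
  `η_σ`, the energy flux `(E + p)m/ρ ≲ √M · E` being the only super-linear term), on `{E > Mρ}` it is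
  `≤ K ×` the hot-cell integrand; Grönwall `H ≤ (3δ + KCe^{−λM}) e^{K√M t₁}`, and `e^{−λM}` beats
  `e^{K√M t₁}` — the crux's own why-might-fail, isolated.
* `stub_entropyCoercivity` (S3, size M): COERCIVITY — at each `τ ≤ t₁`, for continuous chamber-valued
  `V`, `∫ h(V | U_cl(τ)) ≤ ε'` forces `∫ (|ρ − ρ_cl| + ‖m − ρ_cl u_cl‖ + |E − E_cl|)(τ) ≤ ε` (uniform
  strong-convexity modulus on a tube around the compact range of `U_cl|[0,t₁]`, `h ≥ m r₀ |V − U_cl|`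
  outside the tube by ray-monotonicity, Cauchy–Schwarz on `𝕋³`).
* Composition `RelEntropyStability_of : S1 → S2 → S3 → RelEntropyStability` (sorry-free): given `ε`,
  take `ε'` from S3, `δ` from S2 at `ε'`; for a competitor `U` the crux's four hypotheses are exactly
  S1's inputs (entropy inequality, residual), S2's inputs (initial entropy, hot cells) and, with S1's
  output, give `H(τ) ≤ ε'`; S3 at `V = U(τ)` is the `L¹` conclusion.

Every `def` of §0 is VERBATIM a `let` of the crux (`ησ`, `Ucl`, `Λ`, `Fl`) or a conjunction of its
hypotheses, so the composition type-checks against the crux by definitional unfolding only.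

Disproof used: none exists for this crux at registration (`ledger crux ls stmt-AtomisticToContinuum-9520`:
no workfiles). Negatives index (`ledger negatives --problem AtomisticToContinuum`, 20 entries): no refuted
statement is a deterministic relative-entropy / PDE statement; S1–S3 are instances of none.
-/

noncomputable section

open MeasureTheory Filter Set
open scoped Topology Classical

namespace Summit.AtomisticToContinuum.HydrodynamicLimit.Cruxes.RelEntropyStability.Birth

open Literature.MathematicalPhysics.KineticTheory
open Literature.Analysis.FunctionSpaces
open Summit.AtomisticToContinuum.HydrodynamicLimit.Theses

-- §0-BEGIN
/-! ## §0 Objects of the line (verbatim the `let`s and hypothesis blocks of the crux) -/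

/-- Conserved state `U = (ρ, m, E)` (density, momentum, total energy). -/
abbrev State : Type := ℝ × V3 × ℝ

/-- The (negative) thermodynamic entropy density of the hard-sphere gas in conserved variables,
`η_σ(ρ, m, E) = −ρ(3/2 log θ − log ρ − f_ex(ρσ³))`, `θ = ⅔(E/ρ − |m|²/(2ρ²))` — verbatim the `ησ` of
the crux. -/
def etaσ (σ : ℝ) (U : State) : ℝ :=
  -(U.1 * (3 / 2 * Real.log (2 / 3 * (U.2.2 / U.1 - ‖U.2.1‖ ^ 2 / (2 * U.1 ^ 2))) - Real.log U.1 -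
    hsExcessFreeEnergy (U.1 * σ ^ 3)))

/-- The conserved fields `U_cl = (ρ, ρu, E)` of the classical solution — verbatim the `Ucl` of the
crux. -/
def Ucl (ρ : ℝ → T3 → ℝ) (u : ℝ → T3 → V3) (θ : ℝ → T3 → ℝ) (s : ℝ) (x : T3) : State :=
  (ρ s x, ρ s x • u s x, totalEnergyDensity (ρ s x) (u s x) (θ s x))

/-- The entropy multiplier `Λ(s,x) = Dη_σ(U_cl(s,x))` — verbatim the `Λ` of the crux. -/
def Lam (σ : ℝ) (ρ : ℝ → T3 → ℝ) (u : ℝ → T3 → V3) (θ : ℝ → T3 → ℝ) (s : ℝ) (x : T3) :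
    State →L[ℝ] ℝ :=
  fderiv ℝ (etaσ σ) (Ucl ρ u θ s x)

/-- The hard-sphere Euler fluxes `F_j(U) = (m_j, (m_j/ρ)m + p e_j, (E + p)m_j/ρ)`,
`p = hsPressure σ ρ θ(U)` — verbatim the `Fl` of the crux. -/
def Fl (σ : ℝ) (j : Fin 3) (U : State) : State :=
  ((U.2.1 j, (U.2.1 j / U.1) • U.2.1 +
      hsPressure σ U.1 (2 / 3 * (U.2.2 / U.1 - ‖U.2.1‖ ^ 2 / (2 * U.1 ^ 2))) •
        EuclideanSpace.single j (1 : ℝ),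
    (U.2.2 + hsPressure σ U.1 (2 / 3 * (U.2.2 / U.1 - ‖U.2.1‖ ^ 2 / (2 * U.1 ^ 2)))) * U.2.1 j / U.1) :
    State)

/-- The three equation-of-state hypotheses of the crux (supplied in the route by the statics supports
`HsEntropyUniformlyConvex` / `HsFreeEnergyConvex`): `f_ex ∈ C²(0, η₀)`, strong convexity of `η_σ` with
modulus `m(E₁)` on each chamber, convexity up to `ρσ³ = 1.1` — verbatim. -/
def EosHyp (σ η₀ c₁ : ℝ) : Prop :=
  ContDiffOn ℝ 2 hsExcessFreeEnergy (Set.Ioo 0 η₀) ∧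
  (∀ E₁ : ℝ, ∃ m : ℝ, 0 < m ∧ ConvexOn ℝ
      {U : State | c₁ / 2 < U.1 ∧ U.1 * σ ^ 3 < η₀ ∧ ‖U.2.1‖ ^ 2 < 2 * U.1 * U.2.2 ∧ U.2.2 < E₁}
      (fun U : State => etaσ σ U - m * (U.1 ^ 2 + ‖U.2.1‖ ^ 2 + U.2.2 ^ 2))) ∧
  ConvexOn ℝ {U : State | 0 < U.1 ∧ U.1 * σ ^ 3 < 11 / 10 ∧ ‖U.2.1‖ ^ 2 < 2 * U.1 * U.2.2} (etaσ σ)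

/-- The chamber of the classical solution: `c₁ ≤ ρ` and `2ρσ³ < η₀` on `[0,T) × 𝕋³` — verbatim. -/
def InChamber (σ η₀ c₁ T : ℝ) (ρ : ℝ → T3 → ℝ) : Prop :=
  ∀ t ∈ Ico 0 T, ∀ x, c₁ ≤ ρ t x ∧ 2 * ρ t x * σ ^ 3 < η₀

/-- An admissible competitor field on `[0,t₁]`: jointly measurable, bounded, continuous in `x`, with
values in the cell chamber `{c₁ ≤ ρ, ρσ³ ≤ 1, |m|² < 2ρE}` — verbatim the four structural hypotheses of
the crux. -/
def IsCompetitor (σ c₁ t₁ : ℝ) (U : ℝ → T3 → State) : Prop :=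
  Measurable (Function.uncurry U) ∧ (∃ B : ℝ, ∀ s x, ‖U s x‖ ≤ B) ∧ (∀ s, Continuous (U s)) ∧
    ∀ s ∈ Icc 0 t₁, ∀ x, c₁ ≤ (U s x).1 ∧ (U s x).1 * σ ^ 3 ≤ 1 ∧
      ‖(U s x).2.1‖ ^ 2 < 2 * (U s x).1 * (U s x).2.2

/-- The RELATIVE ENTROPY functional `H(τ) = ∫ h(U(τ) | U_cl(τ)) dx`,
`h(U | Ū) = η_σ(U) − η_σ(Ū) − Dη_σ(Ū)(U − Ū)` (Dafermos (5.2.12)); at `τ = 0` verbatim the crux's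
initial hypothesis. The intermediate quantity of the line. -/
def relEntropy (σ : ℝ) (ρ : ℝ → T3 → ℝ) (u : ℝ → T3 → V3) (θ : ℝ → T3 → ℝ)
    (U : ℝ → T3 → State) (τ : ℝ) : ℝ :=
  ∫ x, (etaσ σ (U τ x) - etaσ σ (Ucl ρ u θ τ x) - Lam σ ρ u θ τ x (U τ x - Ucl ρ u θ τ x))

/-- The PAIRED FLUX REMAINDER `Q(s) = ∫ Σ_j ∂_jΛ(s,x) · [F_j(U) − F_j(U_cl) − DF_j(U_cl)(U − U_cl)](s,x) dx`
— the quadratic term of Dafermos (5.2.14). -/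
def remainderPairing (σ : ℝ) (ρ : ℝ → T3 → ℝ) (u : ℝ → T3 → V3) (θ : ℝ → T3 → ℝ)
    (U : ℝ → T3 → State) (s : ℝ) : ℝ :=
  ∫ x, ∑ j : Fin 3, Torus.partialDeriv j (Lam σ ρ u θ s) x
    (Fl σ j (U s x) - Fl σ j (Ucl ρ u θ s x) - fderiv ℝ (Fl σ j) (Ucl ρ u θ s x) (U s x - Ucl ρ u θ s x))

/-- The approximate GLOBAL entropy inequality `∫ η_σ(U(τ)) ≤ ∫ η_σ(U(0)) + δ`, `τ ≤ t₁` — verbatim. -/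
def EntropyIneq (σ t₁ δ : ℝ) (U : ℝ → T3 → State) : Prop :=
  ∀ τ ∈ Icc 0 t₁, (∫ x, etaσ σ (U τ x)) ≤ (∫ x, etaσ σ (U 0 x)) + δ

/-- The HOT-CELL functional bound `∫₀^{t₁}∫ 1(E > Mρ)(E^{3/2}ρ^{-1/2} + E + ρ) ≤ C e^{−λM}` for all
`M ≥ 1` — verbatim. -/
def HotCellBound (lam Cexp t₁ : ℝ) (U : ℝ → T3 → State) : Prop :=
  ∀ M : ℝ, 1 ≤ M → (∫ s in Icc 0 t₁, ∫ x, (if M * (U s x).1 < (U s x).2.2 then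
    (U s x).2.2 ^ (3 / 2 : ℝ) / Real.sqrt ((U s x).1) + (U s x).2.2 + (U s x).1 else 0)) ≤
      Cexp * Real.exp (-(lam * M))

/-- The WEAK RESIDUAL bound against `Λ`: `|[∫Λ·U]₀^τ − ∫₀^τ∫(∂_sΛ·U + Σ_j ∂_jΛ·F_j(U))| ≤ δ`,
`τ ≤ t₁` — verbatim. -/
def WeakResidual (σ : ℝ) (ρ : ℝ → T3 → ℝ) (u : ℝ → T3 → V3) (θ : ℝ → T3 → ℝ) (t₁ δ : ℝ)
    (U : ℝ → T3 → State) : Prop :=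
  ∀ τ ∈ Icc 0 t₁, |(∫ x, Lam σ ρ u θ τ x (U τ x)) - (∫ x, Lam σ ρ u θ 0 x (U 0 x)) -
    ∫ s in Icc 0 τ, ∫ x, (Torus.timeDeriv (Lam σ ρ u θ) s x (U s x) +
      ∑ j, Torus.partialDeriv j (Lam σ ρ u θ s) x (Fl σ j (U s x)))| ≤ δ

/-- `L¹`-closeness of a state field `V` to the classical solution at time `τ`:
`∫ (|ρ − ρ_cl| + ‖m − ρ_cl u_cl‖ + |E − E_cl|)(τ) ≤ ε` — verbatim the crux's conclusion at `V = U(τ)`. -/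
def L1CloseAt (ρ : ℝ → T3 → ℝ) (u : ℝ → T3 → V3) (θ : ℝ → T3 → ℝ) (V : T3 → State) (τ ε : ℝ) :
    Prop :=
  (∫ x, (|(V x).1 - ρ τ x| + ‖(V x).2.1 - ρ τ x • u τ x‖ +
    |(V x).2.2 - totalEnergyDensity (ρ τ x) (u τ x) (θ τ x)|)) ≤ ε

/-! ## §1 Stub signatures

Each stub's statement is the `Prop` `Sig.stub_<name>`; the registered obligation is
`theorem stub_<name> : Sig.stub_<name> := by sorry` (§2); the composition `RelEntropyStability_of` takes
the three signatures as hypotheses BY NAME. -/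

/-- **S1 — relative entropy balance with defects (Dafermos (5.2.14) on `𝕋³` with forcing; size M–L).**
For `σ, η₀, c₁ > 0` with the EOS hypotheses, a classical hs-Euler solution in its chamber, `t₁ < T`,
any `δ` and any admissible competitor `U` on `[0,t₁]` satisfying the approximate global entropy
inequality (`+δ`) and the weak-residual bound (`δ`) against `Λ = Dη_σ(U_cl)`:
`H(τ) ≤ H(0) + 2δ − ∫₀^τ Q(s) ds` for all `τ ≤ t₁`. Why plausibly true: `H(τ) − H(0) = [∫η_σ(U)]₀^τ −
[∫η_σ(U_cl)]₀^τ − [∫Λ·(U − U_cl)]₀^τ`; the first bracket is `≤ δ` (hypothesis), the second is `0`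
(entropy conservation of classical solutions: the hard-sphere law is Gibbs-consistent with `η_σ = −ρs`,
`f_ex ∈ C²` on the solution's density range), `[∫Λ·U]₀^τ` is within `δ` of `∫₀^τ∫(∂_sΛ·U + Σ_j∂_jΛ·F_j(U))`
(hypothesis) while `[∫Λ·U_cl]₀^τ` EQUALS the same expression at `U_cl` (FTC + divergence theorem on
`𝕋³`), and the difference of the two integrands is `Σ_j ∂_jΛ·[F_j(U) − F_j(U_cl) − DF_j(U_cl)(U − U_cl)]`
by the compatibility identity `∂_sΛ·V + Σ_j ∂_jΛ·DF_j(U_cl)V = 0` (symmetry of `D²η_σ DF_j` ⟺ existence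
of the entropy flux `η_σ u`). All integrands are bounded and measurable on `(0,τ] × 𝕋³` (convex `η_σ` is
locally Lipschitz on the open chamber, so `η_σ`, `hsPressure` are bounded on the competitor's values;
`s = 0`, where `timeDeriv` is two-sided, is Lebesgue-null), so no Bochner junk intervenes. Why it might
fail: bookkeeping of one-sided time derivatives at `s = 0` and of `deriv f_ex` junk on dense competitor
cells (`η₀ ≤ ρσ³ ≤ 1`) inside `F_j(U)` — bounded by local Lipschitzness of the convex free energy, but
every integrability has to be earned. Leans on: `IsHardSphereEulerSolution` (mass/momentum/energy,
smoothness), `Torus.integral_partialDeriv_eq_zero_holds`, `Torus.IsSmoothSpaceTimeOn.hasDerivWithinAt_integral`,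
Mathlib `ConvexOn.locallyLipschitzOn`-type facts, `intervalIntegral` FTC. -/
def Sig.stub_relEntropyBalance : Prop :=
  ∀ (σ η₀ c₁ : ℝ), 0 < σ → 0 < η₀ → 0 < c₁ → EosHyp σ η₀ c₁ →
    ∀ (T : ℝ) (ρ θ : ℝ → T3 → ℝ) (u : ℝ → T3 → V3), IsHardSphereEulerSolution σ T ρ u θ →
      InChamber σ η₀ c₁ T ρ →
        ∀ t₁ ∈ Ico 0 T, ∀ (δ : ℝ) (U : ℝ → T3 → State), IsCompetitor σ c₁ t₁ U →
          EntropyIneq σ t₁ δ U → WeakResidual σ ρ u θ t₁ δ U →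
            ∀ τ ∈ Icc 0 t₁, relEntropy σ ρ u θ U τ ≤
              relEntropy σ ρ u θ U 0 + 2 * δ - ∫ s in Icc 0 τ, remainderPairing σ ρ u θ U s

/-- **S2 — Grönwall with hot cells (THE HEART; size L).** For `σ, η₀, c₁, λ > 0`, `C`, the EOS
hypotheses, a classical hs-Euler solution in its chamber and `t₁ < T`: for every `ε' > 0` there is
`δ > 0` such that every admissible competitor `U` with `H(0) ≤ δ`, the hot-cell bound
`∫₀^{t₁}∫ 1(E > Mρ)(E^{3/2}ρ^{-1/2} + E + ρ) ≤ C e^{−λM}` (`M ≥ 1`) and the balance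
`H(τ) ≤ H(0) + 2δ − ∫₀^τ Q` (`τ ≤ t₁`, the output of S1) has `H(τ) ≤ ε'` for all `τ ≤ t₁`. Why plausibly
true: `h ≥ 0` (convexity of `η_σ` on the convex set `{0 < ρ, ρσ³ < 1.1, |m|² < 2ρE}` ⊇ chamber ∪ range
of `U_cl`); `|∂_jΛ| ≤ K` on `[0,t₁] × 𝕋³`; on `{E ≤ Mρ}`: `|R_j(U|U_cl)| ≤ K|U − U_cl|² ≤ (K/m)h` within
distance `r₀` of `U_cl` (`F_j ∈ C²` on `{ρσ³ < η₀}`, strong convexity), `|R_j| ≤ K(1 + √M·E)` and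
`h ≥ m r₀|U − U_cl| ≳ E` beyond (fluxes bounded on bounded parts of the chamber since `Z(η)` is bounded
on `[c₁σ³, 1]`, energy flux `(E+p)m/ρ ≤ K E √(E/ρ) ≤ K√M E`, ray-monotonicity of the Bregman
divergence), so `−Q(s) ≤ K√M H(s) + K ∫ 1(E > Mρ)(E^{3/2}ρ^{-1/2} + E + ρ)`; integrate, use the
hot-cell bound, Grönwall for the bounded measurable `H ≥ 0`: `H(τ) ≤ (3δ + KCe^{−λM})e^{K√M t₁}`; choose
`M` with `KCe^{−λM + K√M t₁} ≤ ε'/2`, then `δ`. Why it might fail: the crux's own why-line — the rate on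
`{E ≤ Mρ} ∪` dense cells must be `o(M)` (here `K√M`) to be absorbed by `e^{−λM}` with `λ` FIXED; a rate
`≳ M` (e.g. if the momentum-flux remainder on dense cold cells were only `≲ M h`) breaks `δ`-uniformity
for `t₁ > λ/K`; cubic flux vs quadratic entropy. Leans on: `EosHyp`, Mathlib `ConvexOn`,
`norm_image_sub_le_of_norm_deriv_le`-type Taylor bounds, `MeasureTheory.integral_mono`, a measurable
integral Grönwall (cf. `HsEulerCalc.eq_zero_of_deriv_right_le_mul_self`, `gronwallBound`). -/
def Sig.stub_gronwallHotCells : Prop :=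
  ∀ (σ η₀ c₁ lam Cexp : ℝ), 0 < σ → 0 < η₀ → 0 < c₁ → 0 < lam → EosHyp σ η₀ c₁ →
    ∀ (T : ℝ) (ρ θ : ℝ → T3 → ℝ) (u : ℝ → T3 → V3), IsHardSphereEulerSolution σ T ρ u θ →
      InChamber σ η₀ c₁ T ρ →
        ∀ t₁ ∈ Ico 0 T, ∀ ε' : ℝ, 0 < ε' → ∃ δ : ℝ, 0 < δ ∧
          ∀ U : ℝ → T3 → State, IsCompetitor σ c₁ t₁ U →
            relEntropy σ ρ u θ U 0 ≤ δ → HotCellBound lam Cexp t₁ U →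
              (∀ τ ∈ Icc 0 t₁, relEntropy σ ρ u θ U τ ≤
                relEntropy σ ρ u θ U 0 + 2 * δ - ∫ s in Icc 0 τ, remainderPairing σ ρ u θ U s) →
                ∀ τ ∈ Icc 0 t₁, relEntropy σ ρ u θ U τ ≤ ε'

/-- **S3 — coercivity of the relative entropy (convex analysis; size M).** For `σ, η₀, c₁ > 0`, the
EOS hypotheses, a classical hs-Euler solution in its chamber and `t₁ < T`: for every `ε > 0` there is
`ε' > 0` such that at every `τ ≤ t₁`, every continuous chamber-valued `V : 𝕋³ → State` with
`∫ h(V | U_cl(τ)) ≤ ε'` is `ε`-close to `U_cl(τ)` in `L¹`. Why plausibly true: the range of `U_cl` on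
`[0,t₁] × 𝕋³` is compact and sits inside the strong-convexity chamber with margins (`ρ ≥ c₁ > c₁/2`,
`ρσ³ < η₀/2`, `2ρE − |m|² = 3ρ²θ ≥ 3c₁² min θ > 0`, `E < E₁ := max E_cl + 1`), so for a uniform `r₀` and
the modulus `m = m(E₁)`: `h(V|Ū) ≥ m|V − Ū|²` if `|V − Ū| ≤ r₀` and `h(V|Ū) ≥ m r₀|V − Ū|` otherwise
(ray-monotonicity of the Bregman divergence of the convex `η_σ` on the convex set containing chamber and
tube; `Λ` is the true derivative there); hence `∫|V − Ū| ≤ √(H/m) + H/(m r₀)` (Cauchy–Schwarz, `|𝕋³| = 1`)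
and the `ℓ¹`-sum of components is `≤ 3‖·‖`. Why it might fail: only through Lean junk — `η_σ` continuous
on the closed chamber needs the convexity hypothesis up to `ρσ³ = 1.1 > 1`, and the strict constraint
`|m|² < 2ρE` keeps `log θ` honest; both are supplied. Leans on: `EosHyp`, Mathlib `ConvexOn`,
`StrongConvexOn`-type Bregman bounds, `integral_mono`, `inner_mul_le_norm_mul_norm` / Jensen. -/
def Sig.stub_entropyCoercivity : Prop :=
  ∀ (σ η₀ c₁ : ℝ), 0 < σ → 0 < η₀ → 0 < c₁ → EosHyp σ η₀ c₁ →
    ∀ (T : ℝ) (ρ θ : ℝ → T3 → ℝ) (u : ℝ → T3 → V3), IsHardSphereEulerSolution σ T ρ u θ →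
      InChamber σ η₀ c₁ T ρ →
        ∀ t₁ ∈ Ico 0 T, ∀ ε : ℝ, 0 < ε → ∃ ε' : ℝ, 0 < ε' ∧
          ∀ τ ∈ Icc 0 t₁, ∀ V : T3 → State, Continuous V →
            (∀ x, c₁ ≤ (V x).1 ∧ (V x).1 * σ ^ 3 ≤ 1 ∧ ‖(V x).2.1‖ ^ 2 < 2 * (V x).1 * (V x).2.2) →
              (∫ x, (etaσ σ (V x) - etaσ σ (Ucl ρ u θ τ x) - Lam σ ρ u θ τ x (V x - Ucl ρ u θ τ x)))
                  ≤ ε' →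
                L1CloseAt ρ u θ V τ ε
-- §1-END

/-! ## §2 Stubs (registered; `sorry` only inside them) — hardest: `stub_gronwallHotCells` -/

/-- **S1 (M–L).** Relative entropy balance with entropy and residual defects. -/
theorem stub_relEntropyBalance : Sig.stub_relEntropyBalance := by
  sorry

/-- **S2 (L; the heart).** Grönwall with hot cells: `e^{−λM}` beats `e^{K√M t₁}`. -/
theorem stub_gronwallHotCells : Sig.stub_gronwallHotCells := by
  sorry

/-- **S3 (M).** Coercivity: small relative entropy forces `L¹`-closeness on the chamber. -/
theorem stub_entropyCoercivity : Sig.stub_entropyCoercivity := by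
  sorry

/-! ## §3 Composition (sorry-free) -/

/-- **The line closes the crux modulo its stubs**: `RelEntropyStability` BY NAME from S1, S2, S3. Real
content: the order of choices (`ε'` from coercivity BEFORE `δ` from the Grönwall step), the packaging
of the crux's eleven hypotheses into the inputs of the three stubs, and the chaining
coercivity ∘ Grönwall ∘ balance at each `τ ≤ t₁`; the `let`s of the crux are matched definitionally by
the §0 objects. -/
theorem RelEntropyStability_of (h₁ : Sig.stub_relEntropyBalance) (h₂ : Sig.stub_gronwallHotCells)
    (h₃ : Sig.stub_entropyCoercivity) : StiffCollisionalRelaxation.RelEntropyStability := by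
  intro σ η₀ c₁ lam Cexp hσ hη₀ hc₁ hlam ησ hC2 hsc hconv T ρ θ u hsol hguard Ucl' Λ Fl' t₁ ht₁ ε hε
  -- the EOS block and the chamber, packaged
  have hE : EosHyp σ η₀ c₁ := ⟨hC2, hsc, hconv⟩
  have hch : InChamber σ η₀ c₁ T ρ := hguard
  -- S3 first: the entropy smallness ε' that forces ε-closeness in L¹
  obtain ⟨ε', hε', H₃⟩ := h₃ σ η₀ c₁ hσ hη₀ hc₁ hE T ρ θ u hsol hch t₁ ht₁ ε hε
  -- S2: the defect size δ that keeps H ≤ ε' on [0, t₁]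
  obtain ⟨δ, hδ, H₂⟩ := h₂ σ η₀ c₁ lam Cexp hσ hη₀ hc₁ hlam hE T ρ θ u hsol hch t₁ ht₁ ε' hε'
  refine ⟨δ, hδ, ?_⟩
  intro U hUm hUb hUc hUval hU0 hUent hUhot hUres τ hτ
  have hcomp : IsCompetitor σ c₁ t₁ U := ⟨hUm, hUb, hUc, hUval⟩
  -- S1: the balance with defects
  have hbal : ∀ τ ∈ Icc 0 t₁, relEntropy σ ρ u θ U τ ≤
      relEntropy σ ρ u θ U 0 + 2 * δ - ∫ s in Icc 0 τ, remainderPairing σ ρ u θ U s :=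
    h₁ σ η₀ c₁ hσ hη₀ hc₁ hE T ρ θ u hsol hch t₁ ht₁ δ U hcomp hUent hUres
  -- S2: Grönwall with hot cells
  have hsmall : relEntropy σ ρ u θ U τ ≤ ε' := H₂ U hcomp hU0 hUhot hbal τ hτ
  -- S3: coercivity at time τ
  exact H₃ τ hτ (U τ) (hUc τ) (hUval τ hτ) hsmall

/-- The skeleton instantiated: the crux modulo the three registered stubs. -/
theorem RelEntropyStability_skeleton : StiffCollisionalRelaxation.RelEntropyStability :=
  RelEntropyStability_of stub_relEntropyBalance stub_gronwallHotCells stub_entropyCoercivity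

end Summit.AtomisticToContinuum.HydrodynamicLimit.Cruxes.RelEntropyStability.Birth

end
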